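import Literature.Computability.QuantumComplexity.JonesInBQPProofs
import Literature.Computability.Cryptography.PolyTimeComputableRealsSqrt
import HarnessLib

/-!
# The entries of the AJL gate set are polynomial-time computable (discharge of `ajlGateSet_polyTimeEntries`)

Topic `Literature/Computability/QuantumComplexity`; sibling proof file of `JonesInBQPProofs.lean`,
discharging its named fact `ajlGateSet_polyTimeEntries`:
`∀ g i j, ajlGateSet.mat g i j ∈ polyTimeComputableComplex` — every entry of every gate of the
Aharonov–Jones–Landau gate set at `k = 5` (Clifford+`T` together with the controlled crossing gate
`controlledGate (A^{±1} Φ_loc + A^{∓1} 1)` and its inverse) is a complex number whose real and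
imaginary parts are polynomial-time computable reals (Ko 1991, Def. 2.1; Bernstein–Vazirani 1997,
Def. 3.2 and §6, the amplitude class `C̃`).

The cited argument: the entries are algebraic numbers — `0, 1, ±1/√2, i, e^{iπ/4}` and products of
`A_5^{±1} = e^{±2πi/5}` with `√(λ_b λ_{b'})/λ_z`, `λ_ℓ = sin(πℓ/5)` — and real algebraic numbers are
polynomial-time computable (Ko 1991, §2.2). As formalised: the Clifford+`T` half is
`cliffordT_polyTimeEntries` (`Cryptography/CliffordTPolyTimeEntries.lean`); for the crossing gates,
all the real constants lie in the closure of `ℚ` under field operations and square roots, which is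
inside `P_ℝ` by `PolyTimeComputableReals.lean` / `PolyTimeComputableRealsSqrt.lean` (Ko 1991, §2.2:
`P_ℝ` is a real closed field): `cos(π/5) = (1 + √5)/4` (Mathlib's `Real.cos_pi_div_five`),
`cos(jπ/5)` by the Chebyshev recursion `cos((j+2)θ) = 2cos θ cos((j+1)θ) − cos(jθ)`,
`sin(jπ/5) = √(1 − cos²(jπ/5))` on `[0, π]`, the point `A_5 = i e^{-iπ/10} = sin(π/10) + i cos(π/10)`
by the half-angle formulas, and then `Φ_loc`, the crossing unitaries and their controlled versions
entry by entry.

## References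

* K.-I. Ko, *Complexity Theory of Real Functions*, Birkhäuser 1991, Def. 2.1, §2.2 (`P_ℝ` is a real
  closed field; real algebraic numbers are polynomial-time computable) [Ko1991].
* E. Bernstein, U. Vazirani, *Quantum complexity theory*, SIAM J. Comput. 26 (1997), Def. 3.2, §6
  [BernsteinVazirani1997].
* D. Aharonov, V. Jones, Z. Landau, Algorithmica 55 (2009) = arXiv:quant-ph/0511096, §2.12–§2.13,
  Claim 3.2 (the gates) [AharonovJonesLandau2009].
-/

noncomputable section

namespace Literature.Computability.QuantumComplexity

open Literature.Computability.Cryptography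

/-! ### Real constants: `√5`, `cos(jπ/5)`, `sin(jπ/5)`, `cos(π/10)`, `sin(π/10)` -/

/-- `cos(π/5) = (1 + √5)/4 ∈ P_ℝ`. [cite: Ko1991, §2.2] -/
theorem isPolyTimeComputableReal_cos_pi_div_five : IsPolyTimeComputableReal (Real.cos (Real.pi / 5)) := by
  rw [Real.cos_pi_div_five]
  exact (isPolyTimeComputableReal_one.add (IsPolyTimeComputableReal.ofNat 5).sqrt).div (IsPolyTimeComputableReal.ofNat 4)

/-- **Chebyshev**: if `cos θ ∈ P_ℝ` then `cos(jθ) ∈ P_ℝ` for all `j : ℕ`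
(`cos((j+2)θ) = 2 cos θ cos((j+1)θ) − cos(jθ)`). [cite: Ko1991, §2.2] -/
theorem isPolyTimeComputableReal_cos_nat_mul {θ : ℝ} (hc : IsPolyTimeComputableReal (Real.cos θ)) (j : ℕ) :
    IsPolyTimeComputableReal (Real.cos (j * θ)) := by
  suffices h : ∀ j : ℕ, IsPolyTimeComputableReal (Real.cos (j * θ)) ∧ IsPolyTimeComputableReal (Real.cos ((j + 1 : ℕ) * θ)) from
    (h j).1
  intro j
  induction j with
  | zero => exact ⟨by simpa using isPolyTimeComputableReal_one, by simpa using hc⟩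
  | succ j ih =>
    refine ⟨ih.2, ?_⟩
    have e : Real.cos ((j + 1 + 1 : ℕ) * θ) = 2 * Real.cos θ * Real.cos ((j + 1 : ℕ) * θ) - Real.cos (j * θ) := by
      have h1 := Real.cos_add ((j + 1 : ℕ) * θ) θ
      have h2 := Real.cos_sub ((j + 1 : ℕ) * θ) θ
      have e1 : ((j + 1 + 1 : ℕ) : ℝ) * θ = (j + 1 : ℕ) * θ + θ := by push_cast; ring
      have e2 : (j : ℝ) * θ = (j + 1 : ℕ) * θ - θ := by push_cast; ring
      rw [e1, e2, h1, h2]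
      ring
    rw [e]
    exact (((IsPolyTimeComputableReal.ofNat 2).mul hc).mul ih.2).sub ih.1

/-- `cos(jπ/5) ∈ P_ℝ`. [cite: Ko1991, §2.2] -/
theorem isPolyTimeComputableReal_cos_mul_pi_div_five (j : ℕ) : IsPolyTimeComputableReal (Real.cos (j * (Real.pi / 5))) :=
  isPolyTimeComputableReal_cos_nat_mul isPolyTimeComputableReal_cos_pi_div_five j

/-- On `[0, π]`, `sin x = √(1 − cos² x)`; so `sin x ∈ P_ℝ` if `cos x ∈ P_ℝ`. [cite: Ko1991, §2.2] -/
theorem isPolyTimeComputableReal_sin_of_cos {x : ℝ} (h0 : 0 ≤ x) (hπ : x ≤ Real.pi)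
    (hc : IsPolyTimeComputableReal (Real.cos x)) : IsPolyTimeComputableReal (Real.sin x) := by
  rw [Real.sin_eq_sqrt_one_sub_cos_sq h0 hπ]
  exact (isPolyTimeComputableReal_one.sub (hc.pow 2)).sqrt

/-- `sin(jπ/5) ∈ P_ℝ` for `j ≤ 5`. [cite: Ko1991, §2.2] -/
theorem isPolyTimeComputableReal_sin_mul_pi_div_five {j : ℕ} (hj : j ≤ 5) :
    IsPolyTimeComputableReal (Real.sin (j * (Real.pi / 5))) := by
  have hj' : (j : ℝ) ≤ 5 := by exact_mod_cast hj
  refine isPolyTimeComputableReal_sin_of_cos (by positivity) ?_ (isPolyTimeComputableReal_cos_mul_pi_div_five j)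
  have := Real.pi_pos
  nlinarith

/-- `cos(π/10) = √((1 + cos(π/5))/2) ∈ P_ℝ`. [cite: Ko1991, §2.2] -/
theorem isPolyTimeComputableReal_cos_pi_div_ten : IsPolyTimeComputableReal (Real.cos (Real.pi / 10)) := by
  have hπ := Real.pi_pos
  rw [show Real.pi / 10 = Real.pi / 5 / 2 by ring, Real.cos_half (by linarith) (by linarith)]
  exact ((isPolyTimeComputableReal_one.add isPolyTimeComputableReal_cos_pi_div_five).div (IsPolyTimeComputableReal.ofNat 2)).sqrt

/-- `sin(π/10) = √((1 − cos(π/5))/2) ∈ P_ℝ`. [cite: Ko1991, §2.2] -/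
theorem isPolyTimeComputableReal_sin_pi_div_ten : IsPolyTimeComputableReal (Real.sin (Real.pi / 10)) := by
  have hπ := Real.pi_pos
  rw [show Real.pi / 10 = Real.pi / 5 / 2 by ring, Real.sin_half_eq_sqrt (by linarith) (by linarith)]
  exact ((isPolyTimeComputableReal_one.sub isPolyTimeComputableReal_cos_pi_div_five).div (IsPolyTimeComputableReal.ofNat 2)).sqrt

/-! ### The AJL weights, the point `A_5`, and the crossing gates -/

/-- **The weights `λ_ℓ = sin(πℓ/5)` (and `0` off `{1,…,4}`) are in `P_ℝ`.** [cite: Ko1991, §2.2] -/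
theorem isPolyTimeComputableReal_ajlWeight_five (ℓ : ℤ) : IsPolyTimeComputableReal (ajlWeight 5 ℓ) := by
  unfold ajlWeight
  split_ifs with h
  · obtain ⟨j, rfl⟩ : ∃ j : ℕ, ℓ = j := Int.eq_ofNat_of_zero_le (by omega)
    have hj : j ≤ 5 := by omega
    have e : Real.pi * ((j : ℤ) : ℝ) / ((5 : ℕ) : ℝ) = j * (Real.pi / 5) := by push_cast; ring
    rw [e]
    exact isPolyTimeComputableReal_sin_mul_pi_div_five hj
  · exact isPolyTimeComputableReal_zero

/-- **The entries of `Φ_loc` are in `P_ℝ`** (`√(λ_b λ_{b'})/λ_z` or `0`). [cite: Ko1991, §2.2] -/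
theorem isPolyTimeComputableReal_ajlLocalPhi (q p : Cryptography.QReg 6) : IsPolyTimeComputableReal (ajlLocalPhi q p) := by
  rw [ajlLocalPhi_apply]
  split_ifs
  · exact ((isPolyTimeComputableReal_ajlWeight_five _).mul (isPolyTimeComputableReal_ajlWeight_five _)).sqrt.div
      (isPolyTimeComputableReal_ajlWeight_five _)
  · exact isPolyTimeComputableReal_zero

/-- **`A_5 = i e^{-iπ/10} = sin(π/10) + i cos(π/10) ∈ C̃`.** [cite: BernsteinVazirani1997, Def. 3.2 and §6] -/
theorem isPolyTimeComputableComplex_ajlPoint_five : IsPolyTimeComputableComplex (ajlPoint 5) := by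
  have e10 : Real.pi / (2 * ((5 : ℕ) : ℝ)) = Real.pi / 10 := by push_cast; ring
  have hθ : IsPolyTimeComputableComplex (Complex.exp ((-(Real.pi / (2 * ((5 : ℕ) : ℝ))) : ℝ) * Complex.I)) := by
    refine IsPolyTimeComputableComplex.exp_mul_I ?_ ?_
    · rw [Real.cos_neg, e10]; exact isPolyTimeComputableReal_cos_pi_div_ten
    · rw [Real.sin_neg, e10]; exact isPolyTimeComputableReal_sin_pi_div_ten.neg
  unfold ajlPoint
  rw [← Complex.ofReal_neg]
  exact isPolyTimeComputableComplex_I.mul hθ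

/-- `A_5⁻¹ = conj A_5 ∈ C̃`. [cite: BernsteinVazirani1997, Def. 3.2 and §6] -/
theorem isPolyTimeComputableComplex_ajlPoint_five_inv : IsPolyTimeComputableComplex (ajlPoint 5)⁻¹ := by
  rw [ajlPoint_inv]
  exact isPolyTimeComputableComplex_ajlPoint_five.conj

/-- The crossing weights `A_5^{±1}` are in `C̃`. [cite: BernsteinVazirani1997, Def. 3.2 and §6] -/
theorem isPolyTimeComputableComplex_crossingWeight_five (positive smooth : Bool) :
    IsPolyTimeComputableComplex (crossingWeight (ajlPoint 5) positive smooth) := by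
  unfold crossingWeight
  exact isPolyTimeComputableComplex_ajlPoint_five.ite isPolyTimeComputableComplex_ajlPoint_five_inv

/-- **The entries of the local crossing unitaries `A^{±1}Φ_loc + A^{∓1}1` are in `C̃`.**
[cite: BernsteinVazirani1997, Def. 3.2 and §6] -/
theorem isPolyTimeComputableComplex_ajlLocalCrossing (positive : Bool) (s t : Cryptography.QReg 6) :
    IsPolyTimeComputableComplex (ajlLocalCrossing positive s t) := by
  unfold ajlLocalCrossing
  simp only [Matrix.add_apply, Matrix.smul_apply, Matrix.map_apply, Matrix.one_apply, smul_eq_mul]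
  exact ((isPolyTimeComputableComplex_crossingWeight_five _ _).mul
    (IsPolyTimeComputableComplex.ofReal (isPolyTimeComputableReal_ajlLocalPhi s t))).add
    ((isPolyTimeComputableComplex_crossingWeight_five _ _).mul
      (isPolyTimeComputableComplex_one.ite isPolyTimeComputableComplex_zero))

/-- **The entries of the controlled crossing gates are in `C̃`** (`0`, `1`, or an entry of the local
crossing unitary). [cite: BernsteinVazirani1997, Def. 3.2 and §6] -/
theorem isPolyTimeComputableComplex_ajlCrossingGate (positive : Bool) (q p : Cryptography.QReg 7) :
    IsPolyTimeComputableComplex (ajlCrossingGate positive q p) := by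
  unfold ajlCrossingGate controlledGate
  rw [Matrix.of_apply]
  exact ((isPolyTimeComputableComplex_ajlLocalCrossing positive _ _).ite
    (isPolyTimeComputableComplex_one.ite isPolyTimeComputableComplex_zero)).ite isPolyTimeComputableComplex_zero

/-! ### The discharge -/

/-- **Discharge of the named fact `ajlGateSet_polyTimeEntries`**: every entry of every gate of the AJL
gate set — Clifford+`T` (`cliffordT_polyTimeEntries`: `0, 1, ±1/√2, i, e^{iπ/4}`) and the two
controlled crossing gates (products of `A_5^{±1} = e^{±2πi/5}` with `√(λ_b λ_{b'})/λ_z`,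
`λ_ℓ = sin(πℓ/5)`, all in the square-root closure of `ℚ`) — is a polynomial-time computable complex
number (Ko 1991: real algebraic numbers, indeed all of the real-closed field `P_ℝ`; Bernstein–Vazirani
1997, Def. 3.2: the amplitude class `C̃`). [cite: Ko1991, §2.2] -/
theorem ajlGateSet_polyTimeEntries_holds : ajlGateSet_polyTimeEntries := by
  unfold ajlGateSet_polyTimeEntries
  rintro (g | positive) i j
  · exact cliffordT_polyTimeEntries g i j
  · rw [mem_polyTimeComputableComplex_iff]
    exact isPolyTimeComputableComplex_ajlCrossingGate positive i j

end Literature.Computability.QuantumComplexity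

end
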